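import Literature.MathematicalPhysics.QuantumLattice.HubbardGapBounds
import HarnessLib

/-!
# Hop weights and hole/doublon counting for the Hubbard hopping terms (occupation basis)

Topic `MathematicalPhysics/QuantumLattice` (family `hubbard`); part 1 of the hole/doublon counting bound
on the Hubbard kinetic energy (part 2: `HubbardHoleCountingBound.lean`). For the hopping terms
`T_b = c†_{xσ}c_{yσ}`, `b = (x, y, σ)` (`bondOp`), in the occupation basis of the Jordan–Wigner Fock
space (`hopBack b s = (s ∖ {xσ}) ∪ {yσ}` is the configuration the hop leads into `s` from) we PROVE:

* `norm_expect_bondOp_le` — `|⟨φ, T_b φ⟩| ≤ Σ_s 1(xσ ∈ s, yσ ∉ s) |φ(s)| |φ(hopBack b s)|`;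
* occupation bookkeeping of one hop (`orb_fst_mem_hopBack_iff`, `orb_snd_mem_hopBack_iff`,
  `occupied_fst_hopBack_iff`, `doublyOccupied_snd_hopBack_iff`, `hopBack_hopBack`);
* `sum_weight_inv_hopBack_eq` — **hop reversal**: with the weight
  `c_{xy}(s) = ω^{1(y occupied)} ω^{-1(x doubly occupied)}` the hop-back map is a bijection from the
  configurations the hop `(x,y,σ)` leads into onto those the reversed hop `(y,x,σ)` leads into, carrying
  `c_{xy}⁻¹` to `c_{yx}`;
* `norm_expect_bondOp_le_weighted` — Young's inequality with these weights:
  `|⟨φ, T_{(x,y,σ)} φ⟩| ≤ ½ Σ_s [1(xσ∈s,yσ∉s) c_{xy}(s) + 1(yσ∈s,xσ∉s) c_{yx}(s)] |φ(s)|²`;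
* `sum_spin_weight_le` — configuration-wise, `Σ_σ 1(xσ∈s, yσ∉s) c_{xy}(s) ≤ 1(y empty) +
  (1 + 2ω⁻¹) 1(x doubly occupied) + ω` (a hop into `s` fills a hole at `y`'s partner... the four cases:
  single→empty `1`, single→opposite single `ω`, doublon←empty `2ω⁻¹`, doublon←single `1`);
* counting over a graph of maximal degree `≤ Δ` (`sum_ite_adj_le`, `sum_ite_empty_eq`:
  `#empty(s) = |Λ| - |s| + #dbl(s)`, `sum_adj_weight_le`):
  `Σ_{x∼y} Σ_σ 1(xσ∈s, yσ∉s) c_{xy}(s) ≤ Δ(|Λ| - |s| + #dbl(s)) + (1 + 2ω⁻¹)Δ #dbl(s) + ωΔ|Λ|`.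

Everything is proved; no definition and no named fact. [folklore] (Gershgorin / Schur-test bookkeeping
for the hole-hopping graph of Y. Nagaoka, Phys. Rev. 147 (1966) 392, §II, and W. F. Brinkman,
T. M. Rice, Phys. Rev. B 2 (1970) 1324, §II; the `ω`-weights handle doublons at finite `U`).

## Mathlib / tree search

Tree (REUSED): `bondOp`, `hopBack`, `bondOp_apply_ne_zero`, `sum_norm_bondOp_apply_mul_le`
(`HubbardGapBounds`), `doublyOccupied`, `mem_doublyOccupied` (`HubbardAtomicLimit`), `upPart`, `downPart`,
`card_eq_upPart_add_downPart` (`HubbardLiebConfig`), `orb_eq_orb_iff`. Mathlib: `Finset.sum_nbij'`,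
`Finset.card_union_add_card_inter`, `Finset.card_compl`, `Finset.sum_boole`, `Fin.sum_univ_two`.
-/

noncomputable section

namespace Literature.MathematicalPhysics.QuantumLattice

open Matrix Finset

variable {Λ : Type*} [LinearOrder Λ] [Fintype Λ]

/-! ### One hop: the quadratic form of `T_b` against the hop-back map -/

/-- **One bond.** For `b = (x, y, σ)` with `x ≠ y` and any Fock vector `φ`:
`|⟨φ, T_b φ⟩| ≤ Σ_s 1(xσ ∈ s, yσ ∉ s) |φ(s)| |φ(hopBack b s)|` (the only nonzero entry of the row `s`
of `T_b = c†_{xσ}c_{yσ}` sits at `hopBack b s` and has modulus `≤ 1`). [folklore] -/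
theorem norm_expect_bondOp_le {b : Bond Λ} (hb : b.1 ≠ b.2.1) (φ : Fock (Orb Λ)) :
    ‖star φ ⬝ᵥ (bondOp b *ᵥ φ)‖ ≤
      ∑ s, if orb b.1 b.2.2 ∈ s ∧ orb b.2.1 b.2.2 ∉ s then ‖φ s‖ * ‖φ (hopBack b s)‖ else 0 := by
  classical
  rw [dotProduct]
  refine (norm_sum_le _ _).trans (Finset.sum_le_sum fun s _ => ?_)
  rw [Pi.star_apply, norm_mul, norm_star, Matrix.mulVec, dotProduct]
  have hrow : ‖∑ s', bondOp b s s' * φ s'‖ ≤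
      if orb b.1 b.2.2 ∈ s ∧ orb b.2.1 b.2.2 ∉ s then ‖φ (hopBack b s)‖ else 0 := by
    refine (norm_sum_le _ _).trans ?_
    have h := sum_norm_bondOp_apply_mul_le hb s (w := fun s' => ‖φ s'‖) fun s' => norm_nonneg _
    simpa only [norm_mul] using h
  split_ifs with hP
  · rw [if_pos hP] at hrow
    exact mul_le_mul_of_nonneg_left hrow (norm_nonneg _)
  · rw [if_neg hP] at hrow
    have h0 : ‖∑ s', bondOp b s s' * φ s'‖ = 0 := le_antisymm hrow (norm_nonneg _)
    rw [h0, mul_zero]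

omit [Fintype Λ] in
/-- Membership in the hopped-back configuration `hopBack (x,y,σ) s = insert yσ (s ∖ {xσ})`. [folklore] -/
theorem mem_hopBack_iff (b : Bond Λ) (s : Finset (Orb Λ)) (o : Orb Λ) :
    o ∈ hopBack b s ↔ o = orb b.2.1 b.2.2 ∨ (o ≠ orb b.1 b.2.2 ∧ o ∈ s) := by
  simp [hopBack, Finset.mem_insert, Finset.mem_erase]

omit [Fintype Λ] in
/-- After hopping back along `(x, y, σ)` (`x ≠ y`): the orbital `xτ` is occupied iff it was and
`τ ≠ σ`. [folklore] -/
theorem orb_fst_mem_hopBack_iff {x y : Λ} (hxy : x ≠ y) (σ τ : Fin 2) (s : Finset (Orb Λ)) :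
    orb x τ ∈ hopBack (x, y, σ) s ↔ orb x τ ∈ s ∧ τ ≠ σ := by
  rw [mem_hopBack_iff, orb_eq_orb_iff, Ne, orb_eq_orb_iff]
  constructor
  · rintro (⟨hx, -⟩ | ⟨h1, h2⟩)
    · exact absurd hx hxy
    · exact ⟨h2, fun h => h1 ⟨rfl, h⟩⟩
  · rintro ⟨h1, h2⟩
    exact Or.inr ⟨fun h => h2 h.2, h1⟩

omit [Fintype Λ] in
/-- After hopping back along `(x, y, σ)` (`x ≠ y`): the orbital `yτ` is occupied iff it was or
`τ = σ`. [folklore] -/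
theorem orb_snd_mem_hopBack_iff {x y : Λ} (hxy : x ≠ y) (σ τ : Fin 2) (s : Finset (Orb Λ)) :
    orb y τ ∈ hopBack (x, y, σ) s ↔ orb y τ ∈ s ∨ τ = σ := by
  rw [mem_hopBack_iff, orb_eq_orb_iff, Ne, orb_eq_orb_iff]
  constructor
  · rintro (⟨-, h⟩ | ⟨-, h2⟩)
    · exact Or.inr h
    · exact Or.inl h2
  · rintro (h | h)
    · by_cases hτ : τ = σ
      · exact Or.inl ⟨rfl, hτ⟩
      · exact Or.inr ⟨fun h' => hxy h'.1.symm, h⟩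
    · exact Or.inl ⟨rfl, h⟩

omit [Fintype Λ] in
/-- Hopping back and forth is the identity on admissible configurations: for `xσ ∈ s`,
`yσ ∉ s`, `hopBack (y,x,σ) (hopBack (x,y,σ) s) = s`. [folklore] -/
theorem hopBack_hopBack {x y : Λ} (σ : Fin 2) {s : Finset (Orb Λ)}
    (hx : orb x σ ∈ s) (hy : orb y σ ∉ s) :
    hopBack (y, x, σ) (hopBack (x, y, σ) s) = s := by
  have hy' : orb y σ ∉ s.erase (orb x σ) := fun h => hy (Finset.mem_of_mem_erase h)
  simp only [hopBack]
  rw [Finset.erase_insert hy', Finset.insert_erase hx]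

omit [Fintype Λ] in
/-- Occupation bookkeeping of the hop `(x, y, σ)` (`x ≠ y`, `xσ ∈ s`): after hopping back, `x` is
occupied iff it was DOUBLY occupied. [folklore] -/
theorem occupied_fst_hopBack_iff {x y : Λ} (hxy : x ≠ y) {σ : Fin 2} {s : Finset (Orb Λ)}
    (hx : orb x σ ∈ s) :
    (orb x 0 ∈ hopBack (x, y, σ) s ∨ orb x 1 ∈ hopBack (x, y, σ) s) ↔
      (orb x 0 ∈ s ∧ orb x 1 ∈ s) := by
  rw [orb_fst_mem_hopBack_iff hxy, orb_fst_mem_hopBack_iff hxy]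
  fin_cases σ <;> simp_all

omit [Fintype Λ] in
/-- Occupation bookkeeping of the hop `(x, y, σ)` (`x ≠ y`, `yσ ∉ s`): after hopping back, `y` is
doubly occupied iff it was occupied. [folklore] -/
theorem doublyOccupied_snd_hopBack_iff {x y : Λ} (hxy : x ≠ y) {σ : Fin 2} {s : Finset (Orb Λ)}
    (hy : orb y σ ∉ s) :
    (orb y 0 ∈ hopBack (x, y, σ) s ∧ orb y 1 ∈ hopBack (x, y, σ) s) ↔
      (orb y 0 ∈ s ∨ orb y 1 ∈ s) := by
  rw [orb_snd_mem_hopBack_iff hxy, orb_snd_mem_hopBack_iff hxy]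
  fin_cases σ <;> simp_all

/-! ### Hop reversal: the weighted sum over hop-back images -/

/-- **Hop-reversal symmetry of the weighted count.** With the weight
`c_{xy}(s) = ω^{1(y occupied)} · ω^{-1(x doubly occupied)}`, summing `c_{xy}(s)⁻¹ f(hopBack (x,y,σ) s)`
over the configurations `s` into which the hop `(x,y,σ)` leads equals summing `c_{yx}(s) f(s)` over the
configurations into which the reversed hop `(y,x,σ)` leads (the hop-back map is a bijection between the
two sets exchanging the two weights). [folklore] -/
theorem sum_weight_inv_hopBack_eq {x y : Λ} (hxy : x ≠ y) (σ : Fin 2) (ω : ℝ)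
    (f : Finset (Orb Λ) → ℝ) :
    ∑ s, (if orb x σ ∈ s ∧ orb y σ ∉ s then
        ((if (orb y 0 ∈ s ∨ orb y 1 ∈ s) then ω else 1) *
          (if (orb x 0 ∈ s ∧ orb x 1 ∈ s) then ω⁻¹ else 1))⁻¹ * f (hopBack (x, y, σ) s) else 0) =
    ∑ s, (if orb y σ ∈ s ∧ orb x σ ∉ s then
        ((if (orb x 0 ∈ s ∨ orb x 1 ∈ s) then ω else 1) *
          (if (orb y 0 ∈ s ∧ orb y 1 ∈ s) then ω⁻¹ else 1)) * f s else 0) := by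
  classical
  rw [← Finset.sum_filter, ← Finset.sum_filter]
  refine Finset.sum_nbij' (hopBack (x, y, σ)) (hopBack (y, x, σ)) ?_ ?_ ?_ ?_ ?_
  · intro s hs
    rw [Finset.mem_filter] at hs ⊢
    refine ⟨Finset.mem_univ _, ?_, ?_⟩
    · rw [orb_snd_mem_hopBack_iff hxy]; exact Or.inr rfl
    · rw [orb_fst_mem_hopBack_iff hxy]; exact fun h => h.2 rfl
  · intro s hs
    rw [Finset.mem_filter] at hs ⊢
    refine ⟨Finset.mem_univ _, ?_, ?_⟩
    · rw [orb_snd_mem_hopBack_iff hxy.symm]; exact Or.inr rfl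
    · rw [orb_fst_mem_hopBack_iff hxy.symm]; exact fun h => h.2 rfl
  · intro s hs
    obtain ⟨h1, h2⟩ : orb x σ ∈ s ∧ orb y σ ∉ s := by simpa using hs
    exact hopBack_hopBack σ h1 h2
  · intro s hs
    obtain ⟨h1, h2⟩ : orb y σ ∈ s ∧ orb x σ ∉ s := by simpa using hs
    exact hopBack_hopBack σ h1 h2
  · intro s hs
    obtain ⟨h1, h2⟩ : orb x σ ∈ s ∧ orb y σ ∉ s := by simpa using hs
    simp only [occupied_fst_hopBack_iff hxy h1, doublyOccupied_snd_hopBack_iff hxy h2]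
    by_cases ha : orb x 0 ∈ s ∧ orb x 1 ∈ s <;> by_cases hb : orb y 0 ∈ s ∨ orb y 1 ∈ s <;>
      simp [ha, hb]

/-! ### Young's inequality per bond and the configuration-wise weight bound -/

omit [LinearOrder Λ] [Fintype Λ] in
/-- Weighted Young inequality `ab ≤ (c a² + c⁻¹ b²)/2` for `c > 0`. [folklore] -/
theorem mul_le_half_weighted_sq_add {a b c : ℝ} (hc : 0 < c) :
    a * b ≤ (1 / 2) * (c * a ^ 2 + c⁻¹ * b ^ 2) := by
  have h1 : c * (c * a ^ 2 + c⁻¹ * b ^ 2) = (c * a) ^ 2 + b ^ 2 := by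
    field_simp
  have hkey : c * (2 * (a * b)) ≤ c * (c * a ^ 2 + c⁻¹ * b ^ 2) := by
    rw [h1]
    nlinarith [sq_nonneg (c * a - b)]
  have h2 : 2 * (a * b) ≤ c * a ^ 2 + c⁻¹ * b ^ 2 := le_of_mul_le_mul_left hkey hc
  linarith

omit [LinearOrder Λ] [Fintype Λ] in
/-- The hop weights `ω^{1(p)} ω^{-1(q)}` are positive for `ω > 0`. [folklore] -/
theorem ite_mul_ite_inv_pos {ω : ℝ} (hω : 0 < ω) (p q : Prop) [Decidable p] [Decidable q] :
    0 < (if p then ω else 1) * (if q then ω⁻¹ else 1) := by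
  refine mul_pos ?_ ?_ <;> split_ifs <;> first | exact hω | exact inv_pos.2 hω | norm_num

/-- **One bond, weighted.** For `x ≠ y`, `ω > 0` and the weight
`c_{xy}(s) = ω^{1(y occupied)} ω^{-1(x doubly occupied)}`:
`|⟨φ, T_{(x,y,σ)} φ⟩| ≤ ½ Σ_s [1(xσ∈s, yσ∉s) c_{xy}(s) + 1(yσ∈s, xσ∉s) c_{yx}(s)] |φ(s)|²`
(Young `ab ≤ (c a² + c⁻¹ b²)/2` on each hop, then hop reversal on the `c⁻¹` half). [folklore] -/
theorem norm_expect_bondOp_le_weighted {x y : Λ} (hxy : x ≠ y) (σ : Fin 2) {ω : ℝ} (hω : 0 < ω)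
    (φ : Fock (Orb Λ)) :
    ‖star φ ⬝ᵥ (bondOp (x, y, σ) *ᵥ φ)‖ ≤
      (1 / 2) * ((∑ s, (if orb x σ ∈ s ∧ orb y σ ∉ s then
          ((if (orb y 0 ∈ s ∨ orb y 1 ∈ s) then ω else 1) *
            (if (orb x 0 ∈ s ∧ orb x 1 ∈ s) then ω⁻¹ else 1)) * ‖φ s‖ ^ 2 else 0)) +
        (∑ s, (if orb y σ ∈ s ∧ orb x σ ∉ s then
          ((if (orb x 0 ∈ s ∨ orb x 1 ∈ s) then ω else 1) *
            (if (orb y 0 ∈ s ∧ orb y 1 ∈ s) then ω⁻¹ else 1)) * ‖φ s‖ ^ 2 else 0))) := by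
  rw [← sum_weight_inv_hopBack_eq hxy σ ω (fun s => ‖φ s‖ ^ 2), mul_add, Finset.mul_sum,
    Finset.mul_sum, ← Finset.sum_add_distrib]
  refine (norm_expect_bondOp_le (b := (x, y, σ)) hxy φ).trans (Finset.sum_le_sum fun s _ => ?_)
  dsimp only
  by_cases hP : orb x σ ∈ s ∧ orb y σ ∉ s
  · rw [if_pos hP, if_pos hP, if_pos hP]
    have hc := ite_mul_ite_inv_pos hω (orb y 0 ∈ s ∨ orb y 1 ∈ s) (orb x 0 ∈ s ∧ orb x 1 ∈ s)
    have h := mul_le_half_weighted_sq_add (a := ‖φ s‖) (b := ‖φ (hopBack (x, y, σ) s)‖) hc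
    linarith
  · rw [if_neg hP, if_neg hP, if_neg hP]
    simp

omit [Fintype Λ] in
/-- **Configuration-wise weight bound.** For every configuration `s`, every `ω > 0` and all sites
`x, y`: `Σ_σ 1(xσ∈s, yσ∉s) c_{xy}(s) ≤ 1(y empty) + (1 + 2ω⁻¹) 1(x doubly occupied) + ω` — the hop
into `s` either fills a hole next to... (cases: `x` singly occupied & `y` empty: `1`; `x` singly & `y`
singly of the other spin: `ω`; `x` doubly & `y` empty: `2ω⁻¹`; `x` doubly & `y` singly: `1`).
[folklore] -/
theorem sum_spin_weight_le {ω : ℝ} (hω : 0 < ω) (x y : Λ) (s : Finset (Orb Λ)) :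
    ∑ σ : Fin 2, (if orb x σ ∈ s ∧ orb y σ ∉ s then
        ((if (orb y 0 ∈ s ∨ orb y 1 ∈ s) then ω else 1) *
          (if (orb x 0 ∈ s ∧ orb x 1 ∈ s) then ω⁻¹ else 1)) else 0) ≤
      (if (orb y 0 ∉ s ∧ orb y 1 ∉ s) then 1 else 0) +
        (1 + 2 * ω⁻¹) * (if (orb x 0 ∈ s ∧ orb x 1 ∈ s) then 1 else 0) + ω := by
  have hω' : 0 < ω⁻¹ := inv_pos.2 hω
  have hωω : ω * ω⁻¹ = 1 := mul_inv_cancel₀ hω.ne'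
  rw [Fin.sum_univ_two]
  by_cases hx0 : orb x 0 ∈ s <;> by_cases hx1 : orb x 1 ∈ s <;> by_cases hy0 : orb y 0 ∈ s <;>
    by_cases hy1 : orb y 1 ∈ s <;> simp [hx0, hx1, hy0, hy1, hωω] <;> linarith

/-! ### Counting: degrees, holes and doublons -/

section Counting

variable (G : SimpleGraph Λ) [DecidableRel G.Adj]

omit [LinearOrder Λ] in
/-- Out-degree bound as a real sum: `Σ_y 1(x ∼ y) ≤ Δ`. [folklore] -/
theorem sum_ite_adj_le {Δ : ℕ} (hΔ : ∀ v : Λ, (Finset.univ.filter (G.Adj v)).card ≤ Δ) (x : Λ) :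
    ∑ y, (if G.Adj x y then (1 : ℝ) else 0) ≤ Δ := by
  rw [Finset.sum_boole]
  exact_mod_cast hΔ x

omit [LinearOrder Λ] in
/-- In-degree bound as a real sum: `Σ_x 1(x ∼ y) ≤ Δ` (the graph is symmetric). [folklore] -/
theorem sum_ite_adj_le' {Δ : ℕ} (hΔ : ∀ v : Λ, (Finset.univ.filter (G.Adj v)).card ≤ Δ) (y : Λ) :
    ∑ x, (if G.Adj x y then (1 : ℝ) else 0) ≤ Δ := by
  have h : ∀ x, (if G.Adj x y then (1 : ℝ) else 0) = if G.Adj y x then (1 : ℝ) else 0 := fun x => by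
    by_cases h1 : G.Adj x y
    · rw [if_pos h1, if_pos h1.symm]
    · rw [if_neg h1, if_neg fun h2 => h1 h2.symm]
  simp only [h]
  exact sum_ite_adj_le G hΔ y

/-- The number of doubly occupied sites as an indicator sum. [folklore] -/
theorem sum_ite_doublyOccupied (s : Finset (Orb Λ)) :
    ∑ x : Λ, (if orb x 0 ∈ s ∧ orb x 1 ∈ s then (1 : ℝ) else 0) = (doublyOccupied s).card := by
  rw [Finset.sum_boole]
  congr 2
  ext x
  simp [mem_doublyOccupied]

/-- **Hole count.** The number of EMPTY sites of a configuration `s` is `|Λ| - |s| + #doublyOccupied(s)`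
(sites = empty ⊔ occupied, `|occupied| + |doubly occupied| = |s↑| + |s↓| = |s|`). [folklore] -/
theorem sum_ite_empty_eq (s : Finset (Orb Λ)) :
    ∑ y : Λ, (if orb y 0 ∉ s ∧ orb y 1 ∉ s then (1 : ℝ) else 0) =
      (Fintype.card Λ : ℝ) - s.card + (doublyOccupied s).card := by
  classical
  rw [Finset.sum_boole]
  have hset : (Finset.univ.filter fun y : Λ => orb y 0 ∉ s ∧ orb y 1 ∉ s) =
      (upPart s ∪ downPart s)ᶜ := by
    ext y
    simp [mem_upPart, mem_downPart]
  have h1 : ((upPart s ∪ downPart s)ᶜ).card = Fintype.card Λ - (upPart s ∪ downPart s).card :=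
    Finset.card_compl _
  have h2 := Finset.card_union_add_card_inter (upPart s) (downPart s)
  have h3 := card_eq_upPart_add_downPart s
  have h4 : (upPart s ∪ downPart s).card ≤ Fintype.card Λ := Finset.card_le_univ _
  rw [hset, h1, h3, doublyOccupied, Nat.cast_sub h4]
  push_cast
  have h2' : ((upPart s ∪ downPart s).card : ℝ) + ((upPart s ∩ downPart s).card : ℝ) =
      (upPart s).card + (downPart s).card := by exact_mod_cast h2
  linarith

/-- **Configuration-wise count.** Summing the spin-summed weight bound over ordered adjacent pairs:
`Σ_{x∼y} Σ_σ 1(xσ∈s, yσ∉s) c_{xy}(s) ≤ Δ(#empty(s)) + (1 + 2ω⁻¹)Δ #doublyOccupied(s) + ωΔ|Λ|`,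
with `#empty(s) = |Λ| - |s| + #doublyOccupied(s)`. [folklore] -/
theorem sum_adj_weight_le {Δ : ℕ} (hΔ : ∀ v : Λ, (Finset.univ.filter (G.Adj v)).card ≤ Δ)
    {ω : ℝ} (hω : 0 < ω) (s : Finset (Orb Λ)) :
    ∑ x, ∑ y, (if G.Adj x y then
        ∑ σ : Fin 2, (if orb x σ ∈ s ∧ orb y σ ∉ s then
          ((if (orb y 0 ∈ s ∨ orb y 1 ∈ s) then ω else 1) *
            (if (orb x 0 ∈ s ∧ orb x 1 ∈ s) then ω⁻¹ else 1)) else 0) else 0) ≤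
      Δ * ((Fintype.card Λ : ℝ) - s.card + (doublyOccupied s).card) +
        (1 + 2 * ω⁻¹) * Δ * (doublyOccupied s).card + ω * Δ * Fintype.card Λ := by
  have hE0 : ∀ y : Λ, (0 : ℝ) ≤ (if orb y 0 ∉ s ∧ orb y 1 ∉ s then (1 : ℝ) else 0) := fun y => by
    split_ifs <;> norm_num
  have hD0 : ∀ x : Λ, (0 : ℝ) ≤ (if orb x 0 ∈ s ∧ orb x 1 ∈ s then (1 : ℝ) else 0) := fun x => by
    split_ifs <;> norm_num
  -- step 1: the spin-summed weight bound, bond by bond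
  have step1 : ∑ x, ∑ y, (if G.Adj x y then
      ∑ σ : Fin 2, (if orb x σ ∈ s ∧ orb y σ ∉ s then
        ((if (orb y 0 ∈ s ∨ orb y 1 ∈ s) then ω else 1) *
          (if (orb x 0 ∈ s ∧ orb x 1 ∈ s) then ω⁻¹ else 1)) else 0) else 0) ≤
      ∑ x, ∑ y, ((if G.Adj x y then (1 : ℝ) else 0) * (if orb y 0 ∉ s ∧ orb y 1 ∉ s then (1 : ℝ) else 0) +
        (1 + 2 * ω⁻¹) * ((if G.Adj x y then (1 : ℝ) else 0) * (if orb x 0 ∈ s ∧ orb x 1 ∈ s then (1 : ℝ) else 0)) +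
        ω * (if G.Adj x y then (1 : ℝ) else 0)) := by
    refine Finset.sum_le_sum fun x _ => Finset.sum_le_sum fun y _ => ?_
    by_cases hxy : G.Adj x y
    · simp only [if_pos hxy, one_mul, mul_one]
      exact sum_spin_weight_le hω x y s
    · simp only [if_neg hxy, zero_mul, mul_zero, add_zero, le_refl]
  -- step 2: the three double sums
  have hEsum : ∑ x, ∑ y, (if G.Adj x y then (1 : ℝ) else 0) * (if orb y 0 ∉ s ∧ orb y 1 ∉ s then (1 : ℝ) else 0) ≤
      Δ * ∑ y, (if orb y 0 ∉ s ∧ orb y 1 ∉ s then (1 : ℝ) else 0) := by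
    rw [Finset.sum_comm, Finset.mul_sum]
    refine Finset.sum_le_sum fun y _ => ?_
    rw [← Finset.sum_mul]
    exact mul_le_mul_of_nonneg_right (sum_ite_adj_le' G hΔ y) (hE0 y)
  have hDsum : ∑ x, ∑ y, (if G.Adj x y then (1 : ℝ) else 0) * (if orb x 0 ∈ s ∧ orb x 1 ∈ s then (1 : ℝ) else 0) ≤
      Δ * ∑ x, (if orb x 0 ∈ s ∧ orb x 1 ∈ s then (1 : ℝ) else 0) := by
    rw [Finset.mul_sum]
    refine Finset.sum_le_sum fun x _ => ?_
    rw [← Finset.sum_mul]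
    exact mul_le_mul_of_nonneg_right (sum_ite_adj_le G hΔ x) (hD0 x)
  have hAsum : ∑ x, ∑ y, (if G.Adj x y then (1 : ℝ) else 0) ≤ Δ * Fintype.card Λ := by
    calc ∑ x, ∑ y, (if G.Adj x y then (1 : ℝ) else 0) ≤ ∑ _x : Λ, (Δ : ℝ) :=
          Finset.sum_le_sum fun x _ => sum_ite_adj_le G hΔ x
      _ = Δ * Fintype.card Λ := by rw [Finset.sum_const, Finset.card_univ, nsmul_eq_mul, mul_comm]
  have hsplit : ∑ x, ∑ y, ((if G.Adj x y then (1 : ℝ) else 0) * (if orb y 0 ∉ s ∧ orb y 1 ∉ s then (1 : ℝ) else 0) +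
        (1 + 2 * ω⁻¹) * ((if G.Adj x y then (1 : ℝ) else 0) * (if orb x 0 ∈ s ∧ orb x 1 ∈ s then (1 : ℝ) else 0)) +
        ω * (if G.Adj x y then (1 : ℝ) else 0)) =
      (∑ x, ∑ y, (if G.Adj x y then (1 : ℝ) else 0) * (if orb y 0 ∉ s ∧ orb y 1 ∉ s then (1 : ℝ) else 0)) +
        (1 + 2 * ω⁻¹) * (∑ x, ∑ y, (if G.Adj x y then (1 : ℝ) else 0) * (if orb x 0 ∈ s ∧ orb x 1 ∈ s then (1 : ℝ) else 0)) +
        ω * ∑ x, ∑ y, (if G.Adj x y then (1 : ℝ) else 0) := by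
    simp only [Finset.sum_add_distrib, Finset.mul_sum]
  have hEcard := sum_ite_empty_eq s
  have hDcard := sum_ite_doublyOccupied s
  have hω' : 0 ≤ 1 + 2 * ω⁻¹ := by positivity
  refine step1.trans ?_
  rw [hsplit]
  rw [hEcard] at hEsum
  rw [hDcard] at hDsum
  have h2 := mul_le_mul_of_nonneg_left hDsum hω'
  have h3 := mul_le_mul_of_nonneg_left hAsum hω.le
  linarith

end Counting

end Literature.MathematicalPhysics.QuantumLattice
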